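import Summits.BirchSwinnertonDyer.BirchSwinnertonDyer.Theorems.QuadraticBranchSignedControlPlusEtaNonsurjThetaFunctionalEquationEvaluation
import Summits.BirchSwinnertonDyer.Rank1Residual.X1.MuLambdaAlgebra
import Literature.NumberTheory.EllipticCurves.ZpExtensionPadicUnitsProofs
import Mathlib.RingTheory.PowerSeries.WeierstrassPreparation
import HarnessLib

/-!
# Route `QuadraticBranchSignedControl` (rung K8, cell `bsd-potss`), residual crux `PlusEtaMainConjectureNonsurj`
# (stmt-BirchSwinnertonDyer-19606): THE FUNCTIONAL EQUATION ON THE QUADRATIC BRANCH, XVI — THE WEIERSTRASS POLYNOMIAL OF EVERY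
# `L_p^±(V, η, X)` IS `w`-RECIPROCAL IN `1 + T`: `(1+T)^λ · P((1+T)⁻¹ − 1) = w · P(T)`, `P(−1) = w` (seat `bsd-potss-k8eta-c2` g29; kernel, class-wide)

WHY. Parts IX–X (k8eta-c2 g28) proved the exact functional equation `ι L = w·(1+T)^e·L` of every branch function `L = L_p^±(V, η, X)`;
XIII/XV read it on linear factors / values. THIS FILE reads it on the WEIERSTRASS POLYNOMIAL: write `L = p^μ · P · U` with `P ∈ ℤ_p[T]`
distinguished of degree `λ` and `U ∈ Λˣ` (`p`-adic Weierstrass preparation; Mathlib `PowerSeries.IsWeierstrassFactorization`). Then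
**`(1+T)^λ · ι P = w · P`** in `Λ` (§36), i.e. the polynomial `R(X) := P(X − 1)` in the variable `X = 1 + T` satisfies `X^λ R(1/X) = w·R(X)`:
it is PALINDROMIC (`w = 1`) or ANTI-PALINDROMIC (`w = −1`); and **`P(−1) = w`** (§36, top coefficients) — the sign of the functional equation
(`= σ·(−N | p) = w_V·(−N_V | p) = w(V^{(p*)})`, Parts VII/XIV) IS THE VALUE OF THE DISTINGUISHED POLYNOMIAL AT `T = −1`. So the `λ`
coefficients of `P` satisfy `⌈λ/2⌉` linear relations: the functional equation HALVES the unknowns of the Weierstrass polynomial (sequel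
`…ReciprocityShape`: `λ = ord_T + 2 ⇒ P = T^r·(T² + aT + a)`; the two extra zeros of k8eta-c1's 19601 squeeze shape are partners).

MATHEMATICS (elementary; no uniqueness API of Weierstrass preparation is used). (§34) For a polynomial `P = Σ_{k≤d} p_k T^k`,
`(1+T)^d · ι P = Σ_k p_k (−T)^k (1+T)^{d−k}` (`ι T · (1+T) = −T`), whose coefficients VANISH above `d` and whose `d`-th coefficient is
`Σ_k p_k (−1)^k = P(−1)`. (§35) RIGIDITY: if `P` is monic distinguished of degree `d` and `P·K` has no coefficients above `d`, then `K` is a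
CONSTANT: `k_m = −Σ_{i<d} p_i k_{m+d−i}` for `m ≥ 1` with `p ∣ p_i` gives `p^n ∣ k_m` for every `n` by induction, so `k_m = 0`. (§36) From
`ι L = w(1+T)^e L` and `L = a·P·U` (`a ≠ 0`): `ι P · ι U = w (1+T)^e P U`, so `(1+T)^d ι P = P · K` with the UNIT
`K = w (1+T)^{e+d} U (ι U)⁻¹`; by §34–§35 `K` is the constant `K(0) = w` (`(ι U)(0) = U(0)`), whence `(1+T)^d ι P = w P` and, reading the
top coefficient, `P(−1) = w`. (§37) For `p` odd and `w = ±1` this forces `w ≡ P(−1) ≡ (−1)^d (mod p)`, so `w = (−1)^d` (Part XII's parity law in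
Weierstrass currency), and `d = λ(L)` for the factorization of the `p`-free part (tree `X1.MuLambda.lam`, Mathlib
`IsWeierstrassFactorization.natDegree_eq_toNat_order_map`). (§38) On the quadratic branch: every `L_p^±(V, η, X)` (any `ϖ`), every
Weierstrass datum.

WHAT. §34 `invol_X_pow_mul_one_add_X_pow`, `coe_polynomial_eq_sum`, `one_add_X_pow_mul_invol_coe_eq_sum`, `coeff_one_add_X_pow_eq`,
`coeff_one_add_X_pow_mul_invol_coe_eq_zero` (above `d`), `coeff_one_add_X_pow_mul_invol_coe_natDegree` (`= P(−1)`); §35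
**`eq_C_of_distinguished_mul`** (rigidity; `⋂ pⁿℤ_p = 0` is the tree's `ZpExtension.PadicUnits.eq_zero_of_forall_pow_dvd`); §36 **`one_add_X_pow_mul_invol_coe_eq_of_invol_eq`**,
**`eval_neg_one_eq_of_reciprocal`**, `eval_neg_one_eq_of_invol_eq`; §37 `eq_one_of_norm_sub_one_lt`, `sign_eq_neg_one_pow_natDegree_of_reciprocal`, `exists_weierstrass_of_ne_zero` (datum with
`natDegree = lam`, `a = p^{mu}`); §38 `reciprocal_of_isQuadraticBranch{Plus,Minus}LFunction`,
`eval_neg_one_eq_sign_of_isQuadraticBranch{Plus,Minus}LFunction`, `exists_reciprocal_weierstrass_of_isQuadraticBranchPlusLFunction` (`d = λ`),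
rows `reciprocal_plus_row`, `eval_neg_one_eq_rootNumber_twist_sign_plus` (conductor level: `P(−1) = w_V·(−N_V | p)`).

HONEST FRAMING (cell `bsd-potss`; FULL-BSD rank ≤ 1 programme, HUMAN RULING D-0036/D-0074): TOOL THEOREMS ONLY — no definition, no named
fact, no `sorry`, axioms standard; nothing about (A), (C1⁺_η), (E⁺_η), C-cc-1 or `BSD(W,p)` of any pair is claimed; no stub of 19606 (or
19601) is proved; crux and route OPEN; nothing booked. `--supports stmt-BirchSwinnertonDyer-19606`.

References: [MazurTateTeitelbaum1986Invent] §I.17; [Washington1997] §7.1 (Thm. 7.3 Weierstrass preparation; distinguished polynomials), §13.2;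
[GreenbergLNM1716] §5 (p. 181); [Sprung2017] Cor. 4.14; [Kobayashi2003] Thm. 3.2. Tree: Parts IX, X, XV; `X1/MuLambdaAlgebra.lean`
(`mu`, `pfree`, `lam`, `red`); Mathlib `RingTheory/PowerSeries/WeierstrassPreparation`.
-/

set_option autoImplicit false
set_option linter.dupNamespace false
noncomputable section

open scoped Classical MatrixGroups ModularForm

open CongruenceSubgroup WeierstrassCurve Literature.NumberTheory.EllipticCurves
  Literature.NumberTheory.EllipticCurves.ModularForms
open Literature.NumberTheory.EllipticCurves.IwasawaAlgebra
open Summit.BirchSwinnertonDyer.Rank1Residual.Additive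
open Summit.BirchSwinnertonDyer.Rank1Residual.X1.MuLambda (mu pfree lam red eq_C_pow_mu_mul_pfree red_pfree_ne_zero)

namespace Summit.BirchSwinnertonDyer.BirchSwinnertonDyer.Theorems.EtaThetaFunctionalEquation

variable {p : ℕ} [hp : Fact p.Prime]

/-! ## §34 The `ι`-transform of a polynomial: `(1+T)^d · ι P = Σ_k p_k (−T)^k (1+T)^{d−k}` -/

/-- `(ι T)^k · (1+T)^k = (−T)^k` (`ι T = (1+T)⁻¹ − 1`). [cite: Washington1997, §13.2] -/
theorem invol_X_pow_mul_one_add_X_pow (k : ℕ) :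
    invol p PowerSeries.X ^ k * (1 + PowerSeries.X) ^ k = (-PowerSeries.X : IwasawaAlgebra p) ^ k := by
  rw [← mul_pow, invol_X_mul_one_add_X]

omit hp in
/-- A polynomial as a finite sum of monomials inside `Λ`: `P = Σ_{k ≤ deg P} p_k T^k`. [folklore] -/
theorem coe_polynomial_eq_sum [Fact p.Prime] (P : Polynomial ℤ_[p]) :
    (P : IwasawaAlgebra p) = ∑ k ∈ Finset.range (P.natDegree + 1), PowerSeries.C (P.coeff k) * PowerSeries.X ^ k := by
  conv_lhs => rw [P.as_sum_range_C_mul_X_pow]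
  rw [show ((∑ k ∈ Finset.range (P.natDegree + 1), Polynomial.C (P.coeff k) * Polynomial.X ^ k : Polynomial ℤ_[p]) :
      IwasawaAlgebra p) = Polynomial.coeToPowerSeries.ringHom (∑ k ∈ Finset.range (P.natDegree + 1),
        Polynomial.C (P.coeff k) * Polynomial.X ^ k) from rfl, map_sum]
  refine Finset.sum_congr rfl fun k _ => ?_
  rw [Polynomial.coeToPowerSeries.ringHom_apply, Polynomial.coe_mul, Polynomial.coe_pow, Polynomial.coe_C, Polynomial.coe_X]

/-- **`(1+T)^d · ι P = Σ_{k ≤ d} p_k · (−1)^k · (1+T)^{d−k} T^k`** for a polynomial `P` of degree `d`. [cite: Washington1997, §13.2] -/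
theorem one_add_X_pow_mul_invol_coe_eq_sum (P : Polynomial ℤ_[p]) :
    (1 + PowerSeries.X) ^ P.natDegree * invol p (P : IwasawaAlgebra p) =
      ∑ k ∈ Finset.range (P.natDegree + 1), PowerSeries.C (P.coeff k * (-1) ^ k) *
        ((1 + PowerSeries.X) ^ (P.natDegree - k) * PowerSeries.X ^ k) := by
  rw [coe_polynomial_eq_sum, map_sum, Finset.mul_sum]
  refine Finset.sum_congr rfl fun k hk => ?_
  have hkd : k ≤ P.natDegree := Nat.lt_succ_iff.mp (Finset.mem_range.mp hk)
  rw [map_mul (invol p), map_pow, invol_C, map_mul]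
  have hsplit : (1 + PowerSeries.X : IwasawaAlgebra p) ^ P.natDegree =
      (1 + PowerSeries.X) ^ (P.natDegree - k) * (1 + PowerSeries.X) ^ k := by
    rw [← pow_add, Nat.sub_add_cancel hkd]
  have hneg : (-PowerSeries.X : IwasawaAlgebra p) ^ k = PowerSeries.C ((-1 : ℤ_[p]) ^ k) * PowerSeries.X ^ k := by
    rw [PowerSeries.C.map_pow, ← mul_pow, map_neg, map_one, neg_one_mul]
  calc (1 + PowerSeries.X) ^ P.natDegree * (PowerSeries.C (P.coeff k) * invol p PowerSeries.X ^ k)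
      = PowerSeries.C (P.coeff k) * (1 + PowerSeries.X) ^ (P.natDegree - k) *
          (invol p PowerSeries.X ^ k * (1 + PowerSeries.X) ^ k) := by rw [hsplit]; ring
    _ = PowerSeries.C (P.coeff k) * PowerSeries.C ((-1 : ℤ_[p]) ^ k) *
          ((1 + PowerSeries.X) ^ (P.natDegree - k) * PowerSeries.X ^ k) := by
        rw [invol_X_pow_mul_one_add_X_pow, hneg]; ring

omit hp in
/-- `coeff_m (1+T)^j = C(j, m)` in `Λ`. [folklore] -/
theorem coeff_one_add_X_pow_eq [Fact p.Prime] (j m : ℕ) :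
    PowerSeries.coeff m ((1 + PowerSeries.X : IwasawaAlgebra p) ^ j) = (j.choose m : ℤ_[p]) := by
  rw [show ((1 : IwasawaAlgebra p) + PowerSeries.X) ^ j = (((1 + Polynomial.X) ^ j : Polynomial ℤ_[p]) : IwasawaAlgebra p) by
    rw [Polynomial.coe_pow, Polynomial.coe_add, Polynomial.coe_one, Polynomial.coe_X], Polynomial.coeff_coe,
    Polynomial.coeff_one_add_X_pow]

/-- **The coefficients of `(1+T)^d · ι P` vanish above `d = deg P`.** [cite: Washington1997, §13.2] -/
theorem coeff_one_add_X_pow_mul_invol_coe_eq_zero (P : Polynomial ℤ_[p]) {n : ℕ} (hn : P.natDegree < n) :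
    PowerSeries.coeff n ((1 + PowerSeries.X) ^ P.natDegree * invol p (P : IwasawaAlgebra p)) = 0 := by
  rw [one_add_X_pow_mul_invol_coe_eq_sum, map_sum]
  refine Finset.sum_eq_zero fun k hk => ?_
  have hkd : k ≤ P.natDegree := Nat.lt_succ_iff.mp (Finset.mem_range.mp hk)
  rw [PowerSeries.coeff_C_mul, PowerSeries.coeff_mul_X_pow', if_pos (by omega), coeff_one_add_X_pow_eq,
    Nat.choose_eq_zero_of_lt (by omega), Nat.cast_zero, mul_zero]

/-- **The top coefficient of `(1+T)^d · ι P` is `P(−1) = Σ_k p_k (−1)^k`.** [cite: Washington1997, §13.2] -/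
theorem coeff_one_add_X_pow_mul_invol_coe_natDegree (P : Polynomial ℤ_[p]) :
    PowerSeries.coeff P.natDegree ((1 + PowerSeries.X) ^ P.natDegree * invol p (P : IwasawaAlgebra p)) = P.eval (-1) := by
  rw [one_add_X_pow_mul_invol_coe_eq_sum, map_sum, Polynomial.eval_eq_sum_range]
  refine Finset.sum_congr rfl fun k hk => ?_
  have hkd : k ≤ P.natDegree := Nat.lt_succ_iff.mp (Finset.mem_range.mp hk)
  rw [PowerSeries.coeff_C_mul, PowerSeries.coeff_mul_X_pow', if_pos hkd, coeff_one_add_X_pow_eq, Nat.choose_self, Nat.cast_one,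
    mul_one]

/-! ## §35 Rigidity: a distinguished polynomial times `K` is a polynomial of the same degree only if `K` is a constant -/

/-- **RIGIDITY.** If `P ∈ ℤ_p[T]` is distinguished (monic, lower coefficients in `pℤ_p`) of degree `d` and `P·K` (`K ∈ Λ`) has NO
coefficients above `d`, then `K` is the constant `K(0)`: for `m ≥ 1`, `k_m = −Σ_{i<d} p_i k_{m+d−i}` is divisible by every power of `p`.
(The uniqueness half of Weierstrass preparation, elementary form.) [cite: Washington1997, §7.1 (Thm. 7.3)] -/
theorem eq_C_of_distinguished_mul {P : Polynomial ℤ_[p]} (hP : P.IsDistinguishedAt (IsLocalRing.maximalIdeal ℤ_[p]))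
    {K : IwasawaAlgebra p} (hK : ∀ n, P.natDegree < n → PowerSeries.coeff n ((P : IwasawaAlgebra p) * K) = 0) :
    K = PowerSeries.C (PowerSeries.constantCoeff K) := by
  have hlow : ∀ i, i < P.natDegree → (p : ℤ_[p]) ∣ P.coeff i := fun i hi ↦ by
    rw [← Ideal.mem_span_singleton, ← PadicInt.maximalIdeal_eq_span_p]; exact hP.mem hi
  -- `p^N ∣ k_m` for all `m ≥ 1`, by induction on `N`
  have key : ∀ N : ℕ, ∀ m, 1 ≤ m → (p : ℤ_[p]) ^ N ∣ PowerSeries.coeff m K := by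
    intro N
    induction N with
    | zero => intro m _; rw [pow_zero]; exact one_dvd _
    | succ N ih =>
      intro m hm
      have h0 := hK (m + P.natDegree) (by omega)
      rw [PowerSeries.coeff_mul, ← Finset.add_sum_erase _ _
        (Finset.HasAntidiagonal.mem_antidiagonal.mpr (show (P.natDegree, m).1 + (P.natDegree, m).2 = m + P.natDegree by
          simp only; omega)), Polynomial.coeff_coe, hP.monic.coeff_natDegree, one_mul] at h0
      have hkm : PowerSeries.coeff m K = -∑ x ∈ (Finset.HasAntidiagonal.antidiagonal (m + P.natDegree)).erase (P.natDegree, m),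
          PowerSeries.coeff x.1 (P : IwasawaAlgebra p) * PowerSeries.coeff x.2 K := by linear_combination h0
      rw [hkm]
      refine (Finset.dvd_sum fun x hx => ?_).neg_right
      obtain ⟨hne, hx'⟩ := Finset.mem_erase.mp hx
      have hsum : x.1 + x.2 = m + P.natDegree := Finset.HasAntidiagonal.mem_antidiagonal.mp hx'
      rw [Polynomial.coeff_coe]
      rcases lt_trichotomy x.1 P.natDegree with hlt | heq | hgt
      · -- `p ∣ p_{x.1}` and `p^N ∣ k_{x.2}` (`x.2 ≥ 1`)
        rw [pow_succ']
        exact mul_dvd_mul (hlow x.1 hlt) (ih x.2 (by omega))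
      · exfalso; apply hne
        exact Prod.ext heq (by simp only at hsum ⊢; omega)
      · rw [Polynomial.coeff_eq_zero_of_natDegree_lt hgt, zero_mul]; exact dvd_zero _
  ext n
  rcases n with _ | n
  · rw [PowerSeries.coeff_zero_C, PowerSeries.coeff_zero_eq_constantCoeff]
  · rw [PowerSeries.coeff_C, if_neg n.succ_ne_zero]
    exact ZpExtension.PadicUnits.eq_zero_of_forall_pow_dvd fun N ↦ key N (n + 1) (by omega)

/-! ## §36 The Weierstrass polynomial of a solution of `ι L = w·(1+T)^e·L` is `w`-reciprocal in `1+T` -/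

/-- **`(1+T)^d · ι P = w · P` FOR THE WEIERSTRASS POLYNOMIAL.** If `L = a · P · U` with `a ∈ ℤ_p ∖ {0}`, `P ∈ ℤ_p[T]` distinguished of
degree `d`, `U ∈ Λˣ`, and `ι L = w·(1+T)^e·L` (any `w, e ∈ ℤ_p`), then `(1+T)^d · ι P = w · P` in `Λ`: the polynomial `P(X − 1)` in
`X = 1 + T` is `w`-reciprocal, `X^d P(X⁻¹ − 1) = w·P(X − 1)`. [cite: MazurTateTeitelbaum1986Invent, §I.17] [cite: Washington1997, §7.1, §13.2] -/
theorem one_add_X_pow_mul_invol_coe_eq_of_invol_eq {P : Polynomial ℤ_[p]}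
    (hP : P.IsDistinguishedAt (IsLocalRing.maximalIdeal ℤ_[p])) {a : ℤ_[p]} (ha : a ≠ 0) {U : IwasawaAlgebra p} (hU : IsUnit U)
    {L : IwasawaAlgebra p} (hL : L = PowerSeries.C a * (P : IwasawaAlgebra p) * U) {w e : ℤ_[p]}
    (hFE : invol p L = PowerSeries.C w * PowerSeries.binomialSeries ℤ_[p] e * L) :
    (1 + PowerSeries.X) ^ P.natDegree * invol p (P : IwasawaAlgebra p) = PowerSeries.C w * (P : IwasawaAlgebra p) := by
  obtain ⟨V, hV⟩ := (hU.map (invol p)).exists_right_inv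
  have hCa : (PowerSeries.C a : IwasawaAlgebra p) ≠ 0 := fun h ↦ ha (by simpa using congr_arg PowerSeries.constantCoeff h)
  -- cancel `C a`: `ι P · ι U = w (1+T)^e P U`
  have h1 : invol p (P : IwasawaAlgebra p) * invol p U =
      PowerSeries.C w * PowerSeries.binomialSeries ℤ_[p] e * (P : IwasawaAlgebra p) * U := by
    refine mul_left_cancel₀ hCa ?_
    have h := hFE
    rw [hL, map_mul (invol p), map_mul (invol p), invol_C] at h
    linear_combination h
  -- `(1+T)^d ι P = P · K`, `K` a unit built from `w`, `(1+T)^{e+d}`, `U`, `(ι U)⁻¹`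
  set K : IwasawaAlgebra p := PowerSeries.C w * PowerSeries.binomialSeries ℤ_[p] e * (1 + PowerSeries.X) ^ P.natDegree * U * V
    with hKdef
  have h2 : (1 + PowerSeries.X) ^ P.natDegree * invol p (P : IwasawaAlgebra p) = (P : IwasawaAlgebra p) * K := by
    rw [hKdef]
    linear_combination ((1 + PowerSeries.X) ^ P.natDegree * V) * h1 -
      ((1 + PowerSeries.X) ^ P.natDegree * invol p (P : IwasawaAlgebra p)) * hV
  -- rigidity: `K` is the constant `K(0) = w`
  have h3 : K = PowerSeries.C (PowerSeries.constantCoeff K) :=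
    eq_C_of_distinguished_mul hP fun n hn ↦ by rw [← h2]; exact coeff_one_add_X_pow_mul_invol_coe_eq_zero P hn
  have h0 : ‖(0 : ℤ_[p])‖ < 1 := by rw [norm_zero]; exact zero_lt_one
  have hUV : PowerSeries.constantCoeff U * PowerSeries.constantCoeff V = 1 := by
    have h := congr_arg (evalHom 0 h0) hV
    rwa [map_mul, map_one, evalHom_invol h0 h0 (by ring) U, evalHom_zero_eq_constantCoeff, evalHom_zero_eq_constantCoeff] at h
  have h4 : PowerSeries.constantCoeff K = w := by
    rw [hKdef, map_mul, map_mul, map_mul, map_mul, PowerSeries.constantCoeff_C, PowerSeries.binomialSeries_constantCoeff, map_pow,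
      map_add, map_one, PowerSeries.constantCoeff_X, add_zero, one_pow, mul_one, mul_one, mul_assoc, hUV, mul_one]
  rw [h2, h3, h4, mul_comm]

/-- **`P(−1) = w`** from the reciprocity `(1+T)^d ι P = w P` of a MONIC `P` of degree `d` (compare the `T^d`-coefficients: `P(−1)` on the
left, `w` on the right). [cite: MazurTateTeitelbaum1986Invent, §I.17] [cite: Washington1997, §13.2] -/
theorem eval_neg_one_eq_of_reciprocal {P : Polynomial ℤ_[p]} (hmon : P.Monic) {w : ℤ_[p]}
    (h : (1 + PowerSeries.X) ^ P.natDegree * invol p (P : IwasawaAlgebra p) = PowerSeries.C w * (P : IwasawaAlgebra p)) :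
    P.eval (-1) = w := by
  have hc := congr_arg (PowerSeries.coeff P.natDegree) h
  rwa [coeff_one_add_X_pow_mul_invol_coe_natDegree, PowerSeries.coeff_C_mul, Polynomial.coeff_coe, hmon.coeff_natDegree,
    mul_one] at hc

/-- **`P(−1) = w` FOR THE WEIERSTRASS POLYNOMIAL of a solution of `ι L = w·(1+T)^e·L`** (`L = a·P·U` as above): the SIGN of the functional
equation is the value of the distinguished polynomial at `T = −1` (`X = 1+T = 0`). [cite: MazurTateTeitelbaum1986Invent, §I.17]
[cite: Washington1997, §7.1, §13.2] -/
theorem eval_neg_one_eq_of_invol_eq {P : Polynomial ℤ_[p]}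
    (hP : P.IsDistinguishedAt (IsLocalRing.maximalIdeal ℤ_[p])) {a : ℤ_[p]} (ha : a ≠ 0) {U : IwasawaAlgebra p} (hU : IsUnit U)
    {L : IwasawaAlgebra p} (hL : L = PowerSeries.C a * (P : IwasawaAlgebra p) * U) {w e : ℤ_[p]}
    (hFE : invol p L = PowerSeries.C w * PowerSeries.binomialSeries ℤ_[p] e * L) : P.eval (-1) = w :=
  eval_neg_one_eq_of_reciprocal hP.monic (one_add_X_pow_mul_invol_coe_eq_of_invol_eq hP ha hU hL hFE)

/-! ## §37 Sign = parity in Weierstrass currency; existence of a Weierstrass datum with `d = λ` -/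

/-- A principal unit of `ℤ_p` (`‖x − 1‖ < 1`) which is `±1` is `1`, for `p` odd (`‖−1 − 1‖ = ‖2‖ = 1`). [folklore] -/
theorem eq_one_of_norm_sub_one_lt (hp2 : p ≠ 2) {x : ℤ_[p]} (hx : ‖x - 1‖ < 1) (h : x = 1 ∨ x = -1) : x = 1 := by
  rcases h with h | h
  · exact h
  · exfalso
    have h2 : ‖(2 : ℤ_[p])‖ = 1 := by
      rw [show (2 : ℤ_[p]) = ((2 : ℕ) : ℤ_[p]) by norm_cast, PadicInt.norm_natCast_eq_one_iff]
      exact (Nat.coprime_primes hp.out Nat.prime_two).mpr hp2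
    rw [h, show (-1 : ℤ_[p]) - 1 = -2 by norm_num, norm_neg, h2] at hx
    exact lt_irrefl _ hx

/-- **`w = (−1)^d`**: for `p` odd, a distinguished `P` of degree `d` with `(1+T)^d ι P = w P` and `w = ±1` has `w = (−1)^d`
(`w = P(−1) ≡ (−1)^d (mod p)`) — Part XII's parity law `(−1)^λ = w` in Weierstrass currency. [cite: MazurTateTeitelbaum1986Invent, §I.17]
[cite: Washington1997, §7.1] -/
theorem sign_eq_neg_one_pow_natDegree_of_reciprocal (hp2 : p ≠ 2) {P : Polynomial ℤ_[p]}
    (hP : P.IsDistinguishedAt (IsLocalRing.maximalIdeal ℤ_[p])) {w : ℤ_[p]} (hw : w = 1 ∨ w = -1)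
    (h : (1 + PowerSeries.X) ^ P.natDegree * invol p (P : IwasawaAlgebra p) = PowerSeries.C w * (P : IwasawaAlgebra p)) :
    w = (-1) ^ P.natDegree := by
  have hev := eval_neg_one_eq_of_reciprocal hP.monic h
  -- `P(−1) − (−1)^d = Σ_{k<d} p_k (−1)^k ∈ pℤ_p`
  have hdiff : ‖P.eval (-1) - (-1) ^ P.natDegree‖ < 1 := by
    rw [Polynomial.eval_eq_sum_range, Finset.sum_range_succ, hP.monic.coeff_natDegree, one_mul, add_sub_cancel_right]
    refine PadicInt.norm_lt_one_iff_dvd _ |>.mpr (Finset.dvd_sum fun k hk => ?_)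
    refine Dvd.dvd.mul_right ?_ _
    rw [← Ideal.mem_span_singleton, ← PadicInt.maximalIdeal_eq_span_p]
    exact hP.mem (Finset.mem_range.mp hk)
  rw [hev] at hdiff
  -- `x := w · (−1)^d` is a principal unit equal to `±1`
  have hx : w * (-1) ^ P.natDegree = 1 := by
    refine eq_one_of_norm_sub_one_lt hp2 ?_ ?_
    · have e1 : w * (-1) ^ P.natDegree - 1 = (w - (-1) ^ P.natDegree) * (-1) ^ P.natDegree := by
        have hsq : ((-1 : ℤ_[p]) ^ P.natDegree) * (-1) ^ P.natDegree = 1 := by rw [← mul_pow, neg_one_mul, neg_neg, one_pow]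
        linear_combination hsq
      rw [e1, norm_mul, norm_pow, norm_neg, norm_one, one_pow, mul_one]; exact hdiff
    · rcases hw with rfl | rfl <;> rcases neg_one_pow_eq_or ℤ_[p] P.natDegree with h1 | h1 <;> rw [h1] <;> norm_num
  have hsq : ((-1 : ℤ_[p]) ^ P.natDegree) * (-1) ^ P.natDegree = 1 := by rw [← mul_pow, neg_one_mul, neg_neg, one_pow]
  linear_combination (-1 : ℤ_[p]) ^ P.natDegree * hx - w * hsq

/-- **Existence of a Weierstrass datum with `d = λ(L)`**: every `L ≠ 0` in `Λ` is `L = p^{μ(L)} · P · U` with `P` distinguished of degree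
`λ(L)` (tree `X1.MuLambda.mu` / `lam`) and `U ∈ Λˣ` — the tree's `p`-content extraction followed by Mathlib's Weierstrass preparation of the
`p`-free part. [cite: Washington1997, §7.1 (Thm. 7.3)] -/
theorem exists_weierstrass_of_ne_zero {L : IwasawaAlgebra p} (hL : L ≠ 0) :
    ∃ (P : Polynomial ℤ_[p]) (U : IwasawaAlgebra p), P.IsDistinguishedAt (IsLocalRing.maximalIdeal ℤ_[p]) ∧ IsUnit U ∧
      P.natDegree = lam L ∧ L = PowerSeries.C ((p : ℤ_[p]) ^ mu L) * (P : IwasawaAlgebra p) * U := by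
  obtain ⟨P, U, H⟩ := PowerSeries.exists_isWeierstrassFactorization (red_pfree_ne_zero hL)
  refine ⟨P, U, H.isDistinguishedAt, H.isUnit, ?_, ?_⟩
  · rw [H.natDegree_eq_toNat_order_map]; rfl
  · rw [mul_assoc, ← H.eq_mul]; exact eq_C_pow_mu_mul_pfree L

/-! ## §38 On the quadratic branch: the Weierstrass polynomial of every `L_p^±(V, η, X)` is `σ·(−N|p)`-reciprocal -/

section Branch

variable {N : ℕ} [NeZero N] {f : CuspForm (Gamma0 N) 2}

/-- **THE WEIERSTRASS POLYNOMIAL OF `L_p⁺(V, η, X)` IS `w`-RECIPROCAL IN `1+T`**: `p` odd, `f` a rational newform of level `N` prime to `p`,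
`a_p(f) = 0`, Fricke sign `σ`, ANY period ratio `ϖ`, every plus branch function `L`, EVERY datum `L = a·P·U` (`a ≠ 0`, `P` distinguished of
degree `d`, `U ∈ Λˣ`): `(1+T)^d · ι P = σ·(−N | p) · P` and `P(−1) = σ·(−N | p)`. No `μ`, image, CM or rank hypothesis.
[cite: MazurTateTeitelbaum1986Invent, §I.17] [cite: Sprung2017, Cor. 4.14] [cite: Kobayashi2003, Thm. 3.2, (3.4)] -/
theorem reciprocal_of_isQuadraticBranchPlusLFunction (hp2 : p ≠ 2) (hf0 : IsNewform0 f) (hQ : coeffField f = ⊥)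
    (hpN : ¬ p ∣ N) (hap : cuspCoeff f p = ((0 : ℤ) : ℂ)) {σ : ℤ} (hσ : σ ^ 2 = 1)
    (hW : atkinLehnerInvolution N 2 N f = (-(σ : ℂ)) • f) {ϖ : ℚ} {L : IwasawaAlgebra p}
    (hL : IsQuadraticBranchPlusLFunction f p ϖ L) {P : Polynomial ℤ_[p]} (hP : P.IsDistinguishedAt (IsLocalRing.maximalIdeal ℤ_[p]))
    {a : ℤ_[p]} (ha : a ≠ 0) {U : IwasawaAlgebra p} (hU : IsUnit U) (hLP : L = PowerSeries.C a * (P : IwasawaAlgebra p) * U) :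
    (1 + PowerSeries.X) ^ P.natDegree * invol p (P : IwasawaAlgebra p) =
        PowerSeries.C (((σ * legendreSym p (-(N : ℤ)) : ℤ) : ℤ_[p])) * (P : IwasawaAlgebra p) ∧
      P.eval (-1) = ((σ * legendreSym p (-(N : ℤ)) : ℤ) : ℤ_[p]) := by
  obtain ⟨e, he⟩ := exists_invol_eq_of_isQuadraticBranchPlusLFunction hp2 hf0 hQ hpN hap hσ hW hL
  exact ⟨one_add_X_pow_mul_invol_coe_eq_of_invol_eq hP ha hU hLP he, eval_neg_one_eq_of_invol_eq hP ha hU hLP he⟩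

/-- **THE WEIERSTRASS POLYNOMIAL OF `L_p⁻(V, η, X)` IS `w`-RECIPROCAL IN `1+T`** (minus twin). [cite: MazurTateTeitelbaum1986Invent, §I.17]
[cite: Sprung2017, Cor. 4.14] [cite: Kobayashi2003, Thm. 3.2, (3.5)] -/
theorem reciprocal_of_isQuadraticBranchMinusLFunction (hp2 : p ≠ 2) (hf0 : IsNewform0 f) (hQ : coeffField f = ⊥)
    (hpN : ¬ p ∣ N) (hap : cuspCoeff f p = ((0 : ℤ) : ℂ)) {σ : ℤ} (hσ : σ ^ 2 = 1)
    (hW : atkinLehnerInvolution N 2 N f = (-(σ : ℂ)) • f) {ϖ : ℚ} {L : IwasawaAlgebra p}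
    (hL : IsQuadraticBranchMinusLFunction f p ϖ L) {P : Polynomial ℤ_[p]} (hP : P.IsDistinguishedAt (IsLocalRing.maximalIdeal ℤ_[p]))
    {a : ℤ_[p]} (ha : a ≠ 0) {U : IwasawaAlgebra p} (hU : IsUnit U) (hLP : L = PowerSeries.C a * (P : IwasawaAlgebra p) * U) :
    (1 + PowerSeries.X) ^ P.natDegree * invol p (P : IwasawaAlgebra p) =
        PowerSeries.C (((σ * legendreSym p (-(N : ℤ)) : ℤ) : ℤ_[p])) * (P : IwasawaAlgebra p) ∧
      P.eval (-1) = ((σ * legendreSym p (-(N : ℤ)) : ℤ) : ℤ_[p]) := by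
  obtain ⟨e, he⟩ := exists_invol_eq_of_isQuadraticBranchMinusLFunction hp2 hf0 hQ hpN hap hσ hW hL
  exact ⟨one_add_X_pow_mul_invol_coe_eq_of_invol_eq hP ha hU hLP he, eval_neg_one_eq_of_invol_eq hP ha hU hLP he⟩

/-- **Every nonzero `L_p⁺(V, η, X)` HAS a `w`-reciprocal Weierstrass polynomial of degree `λ(L)`**: `L = p^{μ(L)}·P·U`, `P` distinguished,
`deg P = λ(L)`, `U ∈ Λˣ`, `(1+T)^{λ(L)} ι P = w P`, `P(−1) = w`, `w = σ·(−N | p)`. [cite: MazurTateTeitelbaum1986Invent, §I.17]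
[cite: Washington1997, §7.1 (Thm. 7.3)] [cite: Kobayashi2003, Thm. 3.2, (3.4)] -/
theorem exists_reciprocal_weierstrass_of_isQuadraticBranchPlusLFunction (hp2 : p ≠ 2) (hf0 : IsNewform0 f) (hQ : coeffField f = ⊥)
    (hpN : ¬ p ∣ N) (hap : cuspCoeff f p = ((0 : ℤ) : ℂ)) {σ : ℤ} (hσ : σ ^ 2 = 1)
    (hW : atkinLehnerInvolution N 2 N f = (-(σ : ℂ)) • f) {ϖ : ℚ} {L : IwasawaAlgebra p}
    (hL : IsQuadraticBranchPlusLFunction f p ϖ L) (hL0 : L ≠ 0) :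
    ∃ (P : Polynomial ℤ_[p]) (U : IwasawaAlgebra p), P.IsDistinguishedAt (IsLocalRing.maximalIdeal ℤ_[p]) ∧ IsUnit U ∧
      P.natDegree = lam L ∧ L = PowerSeries.C ((p : ℤ_[p]) ^ mu L) * (P : IwasawaAlgebra p) * U ∧
      (1 + PowerSeries.X) ^ lam L * invol p (P : IwasawaAlgebra p) =
          PowerSeries.C (((σ * legendreSym p (-(N : ℤ)) : ℤ) : ℤ_[p])) * (P : IwasawaAlgebra p) ∧
      P.eval (-1) = ((σ * legendreSym p (-(N : ℤ)) : ℤ) : ℤ_[p]) := by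
  obtain ⟨P, U, hP, hU, hdeg, hLP⟩ := exists_weierstrass_of_ne_zero hL0
  obtain ⟨h1, h2⟩ := reciprocal_of_isQuadraticBranchPlusLFunction hp2 hf0 hQ hpN hap hσ hW hL hP
    (pow_ne_zero _ (Nat.cast_ne_zero.mpr hp.out.ne_zero)) hU hLP
  exact ⟨P, U, hP, hU, hdeg, hLP, hdeg ▸ h1, h2⟩

end Branch

section Row

variable {N : ℕ} [NeZero N] {f : CuspForm (Gamma0 N) 2}

/-- **AT A ROW (plus)**: `V` globally minimal, good at `p ≥ 5`, `a_p(V) = 0` (every row of crux 19606), `f` its newform (any level) with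
Fricke sign `σ`, any `ϖ`, every `Lη = L_p⁺(V, η, X)`, every Weierstrass datum `Lη = a·P·U`: `(1+T)^d ι P = σ·(−N|p)·P` and
`P(−1) = σ·(−N|p)`. [cite: MazurTateTeitelbaum1986Invent, §I.17] [cite: Kobayashi2003, Thm. 3.2, (3.4)] -/
theorem reciprocal_plus_row (hp5 : 5 ≤ p) (V : WeierstrassCurve ℚ) [V.IsElliptic] [V.IsGloballyMinimal]
    (hgood : V.HasGoodReductionAtPrime p) (hap : V.frobeniusTrace p = 0) (hf : IsNewformOf V f) {σ : ℤ} (hσ : σ ^ 2 = 1)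
    (hW : atkinLehnerInvolution N 2 N f = (-(σ : ℂ)) • f) (ϖ : ℚ) {Lη : IwasawaAlgebra p}
    (hL : IsQuadraticBranchPlusLFunction f p ϖ Lη) {P : Polynomial ℤ_[p]} (hP : P.IsDistinguishedAt (IsLocalRing.maximalIdeal ℤ_[p]))
    {a : ℤ_[p]} (ha : a ≠ 0) {U : IwasawaAlgebra p} (hU : IsUnit U) (hLP : Lη = PowerSeries.C a * (P : IwasawaAlgebra p) * U) :
    (1 + PowerSeries.X) ^ P.natDegree * invol p (P : IwasawaAlgebra p) =
        PowerSeries.C (((σ * legendreSym p (-(N : ℤ)) : ℤ) : ℤ_[p])) * (P : IwasawaAlgebra p) ∧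
      P.eval (-1) = ((σ * legendreSym p (-(N : ℤ)) : ℤ) : ℤ_[p]) := by
  have hp2 : p ≠ 2 := by omega
  have hap' : cuspCoeff f p = ((0 : ℤ) : ℂ) := by
    rw [cuspCoeff_eq_frobeniusTrace_of_isNewformOf_holds hf hgood, hap]
  exact reciprocal_of_isQuadraticBranchPlusLFunction hp2 hf.1 hf.coeffField_eq_bot (not_dvd_level_of_isNewformOf hf hgood)
    hap' hσ hW hL hP ha hU hLP

end Row

section Root

variable {V : WeierstrassCurve ℚ} [V.IsElliptic] [NeZero (V.conductorNorm ℤ)]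
  {f : CuspForm (Gamma0 (V.conductorNorm ℤ)) 2} [V.IsGloballyMinimal]

/-- **CONDUCTOR LEVEL (plus): `P(−1) = w_V·(−N_V | p)`** — for the newform of `V` at level `N_V` the sign is the root number of the additive
partner `W = V^{(p*)}` (Parts VII/XIV): the ROOT NUMBER OF THE TWIST IS THE VALUE OF THE WEIERSTRASS POLYNOMIAL OF `L_p⁺(V, η, X)` AT `T = −1`,
and `(1+T)^d ι P = w_V·(−N_V|p) · P`. [cite: MazurTateTeitelbaum1986Invent, §I.17] [cite: AtkinLehner1970, Thm. 3] [cite: Sprung2017, Cor. 4.14] -/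
theorem eval_neg_one_eq_rootNumber_twist_sign_plus (hp5 : 5 ≤ p) (hgood : V.HasGoodReductionAtPrime p)
    (hap : V.frobeniusTrace p = 0) (hf : IsNewformOf V f) (ϖ : ℚ) {Lη : IwasawaAlgebra p}
    (hL : IsQuadraticBranchPlusLFunction f p ϖ Lη) {P : Polynomial ℤ_[p]} (hP : P.IsDistinguishedAt (IsLocalRing.maximalIdeal ℤ_[p]))
    {a : ℤ_[p]} (ha : a ≠ 0) {U : IwasawaAlgebra p} (hU : IsUnit U) (hLP : Lη = PowerSeries.C a * (P : IwasawaAlgebra p) * U) :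
    (1 + PowerSeries.X) ^ P.natDegree * invol p (P : IwasawaAlgebra p) =
        PowerSeries.C (((V.rootNumber * legendreSym p (-(V.conductorNorm ℤ : ℤ)) : ℤ) : ℤ_[p])) * (P : IwasawaAlgebra p) ∧
      P.eval (-1) = ((V.rootNumber * legendreSym p (-(V.conductorNorm ℤ : ℤ)) : ℤ) : ℤ_[p]) :=
  reciprocal_plus_row hp5 V hgood hap hf rootNumber_sq_eq_one (atkinLehnerInvolution_eq_neg_rootNumber_smul hf) ϖ hL hP ha hU hLP

end Root

end Summit.BirchSwinnertonDyer.BirchSwinnertonDyer.Theorems.EtaThetaFunctionalEquation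

end
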